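import Summits.QuantumFields.BalabanUV.T4Continuum.Support.NE7PinnedLandauRepB8
import Summits.QuantumFields.BalabanUV.T4Continuum.Support.AveragingDeficitLiftPeriodic
import HarnessLib

/-!
# NE7PinnedLandauRepDual — «REP WITH A FIXED TOP» FOR THE DUAL (CORNER-CENTRED) TEST CLASS: the PINNED representative `U^u = We^{Z}` (`u(M•z) = 1`), `Z` Landau against the
# TRANSLATE of B8's class by `s` (test generators `ν` with `ν(· − s) ∈ N(Q′(W(· − s)))` — for `s = ⌊M∕2⌋·𝟙` the blocks are CENTRED at the corners), with E′'s radii,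
# MODULO the dual LHCI of `W`; the Galerkin letters of the dual class are row NE3's letters at the translated background, by translation covariance; file 27

Cell `pub-balaban`, rung (B)+1 sub-cell t4, lineage `b2b-balaban-t4-ne7-p1` (CRUX PROVER NE7 #1 = OWNER of row NE7), generation 77; memo
`t4/b2b-balaban-t4-ne7-p1-g77/GAUGED-TOP-TT.md` §4∕§7∕§9∕§10.  File F93 (over F89, F90, F83, F91 §1, row NE3's `exists_landauB8_correction` ∕ `hRW_of_radii` ∕
`supRegularity_uniform`, `AveragingDeficitLiftPeriodic.hol_shift`, `sum_periodBox_shift`).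
WHY (memo §4∕§7∕§10).  The Landau-harmonic corner interpolation is ILL-CONDITIONED for B8's CORNERED blocks (the corners sit on block boundaries, where the potentials of
the alternating block modes vanish: degenerate for even `N`, constants growing with `N` for odd `N` — flat numerics j276031∕j276098∕j276448), and WELL-CONDITIONED, uniformly
in `M` AND `N`, when the test blocks are CENTRED at the corners (j276100∕j276447: `C_I ≲ 60` in `d ≤ 4`).  F91 docked the cornered class; THIS FILE docks the translated class
for an ARBITRARY shift `s` (the dual class is `s = ⌊M∕2⌋·𝟙`): every Galerkin letter of the translated class at `W` is the corresponding letter of B8's class at the translated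
background `W(· − s)` (which lies in the same class), transported by the translation identities of §1 — so, again, the pinned representative exists MODULO the (dual) LHCI alone.
WHAT ([folklore]; 0 def, 0 sorry).  §1 translation identities (`gaugeDir_transl`, `covDiv_transl`, `covLapSite_transl`, `hol_transl`) and class transport (`smallField_transl`,
`plaqGrad_transl`, periodicity).  §2 the Galerkin letters of the translated class at `W` (`galerkin_transl`, `galerkinR_transl`).  §3 **`exists_pinnedLandauRepTransl_of_lhci`** —
the pinned representative, Landau against the `s`-translate of B8's class, with E′'s radii at the PG constants, modulo the translated LHCI (`hI`, `hIu`) by shape.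
HONEST FRAMING (page 1): translation bookkeeping + docking; the LHCI is a HYPOTHESIS (flat numerics only); nothing of Bałaban's asserted; (APE) NOT proved; NOT ONE-STEP, NOT
NE7; spine 0∕9; finite T⁴ rung (B)+1 — NOT infinite volume, NOT mass gap, NOT `BetaPertH`, NOT Clay.  Continuum YM on T⁴ ⇐ BetaPertH ∧ nine spine estimates (0/9 proved);
BetaPertH ⇐ (D1) ∧ (D4) ∧ CAP+tail; G-an2-4 gates asym, D1 and NE2/3/4.
-/

set_option autoImplicit false

open NormedSpace
open scoped BigOperators Matrix.Norms.L2Operator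
open Finset

namespace Summit.QuantumFields.BalabanUV.T4Continuum.NE7PinnedLandauRepDual

open Literature.MathematicalPhysics.QuantumFieldTheory.Balaban1983to89
open B7Prop1Explicit B7Prop2Explicit MatrixLog MatrixNorms
open T4AveragingDeficitWall (Ad IsUnitaryCfg IsSkewDir SmallField vary)
open T4AveragingDeficitWallBoundary (IsPeriodicCfg periodBox sum_periodBox_shift)
open AveragingDeficitPeriodicCounting (IsPeriodicDir)
open AveragingDeficitMultiLevelPrep (LevelSmall)
open AveragingDeficitLiftPeriodic (hol_shift)
open NE3EnergyShapes (IsUnitarySite IsPeriodicSite)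
open NE3CovariantWeitzenbock (covDiv)
open NE3CovariantCalculus (hsR)
open NE3RightInverseSupLetters (frameC)
open BlockAveragePushDirGauge (gaugeDir isPeriodicDir_gaugeDir)
open NE3.PairLandauB8 (covLapSite avgKernelGauges mem_avgKernelGauges_iff IsLandauB8)
open NE3.LandauProjectionB8 (covDiv_gaugeDir_eq_covLapSite covLapSite_add_period exists_landauB8_correction)
open NE3.LandauProjectionSupCurvedUniform (hRW_of_radii)
open NE3.SupRegularityCurvedUniform (supRegularity_uniform)
open NE7PointedSupRegularity (supRegularity_pointed)
open NE7PinnedLandauRepT (exists_pinnedLandauRep_W_T_of_supFacts)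
open NE7PinnedLandauLettersOfLHCI (pinnedProj_of_galerkin_lhci pinnedSupLetter_of_galerkin_lhci)
open NE7PinnedLandauRepB8 (exists_galerkinB8_site)
open PeriodicChoice (wrap_add_smul_e)
open NE3FrameFreeDecompositionPrep (wrap_eq_self_of_mem)

noncomputable section

variable {d : ℕ} {n : Type*} [Fintype n] [DecidableEq n]

/-! ## §1 Translation identities and class transport -/

/-- `gaugeDir` commutes with translations: `gaugeDir (W(·−s)) (λ(·−s)) (y) = gaugeDir W λ (y − s)`. [folklore] -/
theorem gaugeDir_transl (W : Site d → Fin d → (Matrix n n ℂ)ˣ) (lam : Site d → Matrix n n ℂ) (s y : Site d) (κ : Fin d) :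
    gaugeDir (fun y μ => W (y - s) μ) (fun y => lam (y - s)) y κ = gaugeDir W lam (y - s) κ := by
  simp only [gaugeDir, add_sub_right_comm]

/-- `covDiv` commutes with translations. [folklore] -/
theorem covDiv_transl (W : Site d → Fin d → (Matrix n n ℂ)ˣ) (ψ : Site d → Fin d → Matrix n n ℂ) (s x : Site d) :
    covDiv (fun y μ => W (y - s) μ) (fun y κ => ψ (y - s) κ) x = covDiv W ψ (x - s) := by
  simp only [covDiv, sub_right_comm]

/-- `covLapSite` commutes with translations. [folklore] -/
theorem covLapSite_transl (W : Site d → Fin d → (Matrix n n ℂ)ˣ) (lam : Site d → Matrix n n ℂ) (s y : Site d) :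
    covLapSite (fun y μ => W (y - s) μ) (fun y => lam (y - s)) y = covLapSite W lam (y - s) := by
  rw [← covDiv_gaugeDir_eq_covLapSite, ← covDiv_gaugeDir_eq_covLapSite]
  have h : gaugeDir (fun y μ => W (y - s) μ) (fun y => lam (y - s)) = fun y κ => gaugeDir W lam (y - s) κ := by
    funext y κ; exact gaugeDir_transl W lam s y κ
  rw [h, covDiv_transl]

/-- Parallel transport commutes with translations. [folklore] -/
theorem hol_transl (W : Site d → Fin d → (Matrix n n ℂ)ˣ) (s y : Site d) (w : List (Letter d)) :
    hol (fun y μ => W (y - s) μ) y w = hol W (y - s) w := by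
  have h : ∀ (x : Site d) (μ : Fin d), (fun y μ => W (y - s) μ) (x + s) μ = W x μ := fun x μ => by
    simp only [add_sub_cancel_right]
  have := hol_shift (W := W) (W' := fun y μ => W (y - s) μ) (t := s) h w (y - s)
  rwa [sub_add_cancel] at this

/-- The translated background is unitary. [folklore] -/
theorem isUnitaryCfg_transl {W : Site d → Fin d → (Matrix n n ℂ)ˣ} (hWu : IsUnitaryCfg W) (s : Site d) :
    IsUnitaryCfg (fun y μ => W (y - s) μ) := fun y μ => hWu (y - s) μ

/-- The translated background is periodic. [folklore] -/
theorem isPeriodicCfg_transl {W : Site d → Fin d → (Matrix n n ℂ)ˣ} {P : ℤ} (hWP : IsPeriodicCfg W P) (s : Site d) :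
    IsPeriodicCfg (fun y μ => W (y - s) μ) P := by
  intro y κ μ
  show W (y + P • e κ - s) μ = W (y - s) μ
  rw [add_sub_right_comm, hWP]

/-- A translated periodic site function is periodic. [folklore] -/
theorem sitePeriodic_transl {𝔸 : Type*} {f : Site d → 𝔸} {P : ℤ} (hf : ∀ (y : Site d) (i : Fin d), f (y + P • e i) = f y) (s : Site d) :
    ∀ (y : Site d) (i : Fin d), (fun y => f (y - s)) (y + P • e i) = (fun y => f (y - s)) y := by
  intro y i
  show f (y + P • e i - s) = f (y - s)
  rw [add_sub_right_comm, hf]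

/-- The translated background has the same plaquette radius. [folklore] -/
theorem smallField_transl {W : Site d → Fin d → (Matrix n n ℂ)ˣ} {x : ℝ} (hWx : SmallField W x) (s : Site d) :
    SmallField (fun y μ => W (y - s) μ) x := by
  intro y κ κ' hne
  rw [hol_transl]
  exact hWx (y - s) κ κ' hne

/-- The translated background has the same plaquette-gradient radius. [folklore] -/
theorem plaqGrad_transl {W : Site d → Fin d → (Matrix n n ℂ)ˣ} {x₁ : ℝ}
    (hgrad : ∀ (p : Site d) (μ κ : Fin d), κ ≠ μ →
      ‖Ad (W p μ) ((hol W (p + e μ) (plaqWord κ μ) : (Matrix n n ℂ)ˣ) : Matrix n n ℂ) - ((hol W p (plaqWord κ μ) : (Matrix n n ℂ)ˣ) : Matrix n n ℂ)‖ ≤ x₁)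
    (s : Site d) :
    ∀ (p : Site d) (μ κ : Fin d), κ ≠ μ →
      ‖Ad ((fun y μ => W (y - s) μ) p μ) ((hol (fun y μ => W (y - s) μ) (p + e μ) (plaqWord κ μ) : (Matrix n n ℂ)ˣ) : Matrix n n ℂ)
        - ((hol (fun y μ => W (y - s) μ) p (plaqWord κ μ) : (Matrix n n ℂ)ˣ) : Matrix n n ℂ)‖ ≤ x₁ := by
  intro p μ κ hne
  rw [hol_transl, hol_transl, add_sub_right_comm]
  exact hgrad (p - s) μ κ hne

/-! ## §2 The Galerkin letters of the translated class at `W` from B8's letters at the translated background -/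

/-- A sum over the period box of a `P`-periodic real function is invariant under `y ↦ y − s`. [folklore] -/
theorem sum_periodBox_sub {P : ℕ} (hP : 1 ≤ P) {g : Site d → ℝ} (hg : ∀ (x : Site d) (κ : Fin d), g (x + (P : ℤ) • e κ) = g x) (s : Site d) :
    ∑ x ∈ periodBox (d := d) P, g (x - s) = ∑ x ∈ periodBox (d := d) P, g x := by
  have h := sum_periodBox_shift P hP hg (-s)
  simpa only [← sub_eq_add_neg] using h

/-- **GALERKIN PROJECTION OF THE TRANSLATED CLASS (`gaugeDir` form)**: at a `W` of row NE3's class, for every bond field `Y` there is a skew periodic `λ` with `Y + D_Wλ`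
Landau against every periodic `ν` whose translate `ν(· − s)` lies in `N(Q′(W(· − s)))` — `exists_landauB8_correction` at the translated background for the translated
periodisation of `Y`, translated back. [folklore] -/
theorem galerkin_transl [Nonempty n] {L N : ℕ} (hL : 1 ≤ L) (hN : 1 ≤ N) (j : ℕ) {W : Site d → Fin d → (Matrix n n ℂ)ˣ} {x : ℝ}
    (hWu : IsUnitaryCfg W) (hWP : IsPeriodicCfg W ((N * L ^ (j + 1) : ℕ) : ℤ)) (hx : 0 ≤ x) (hs : LevelSmall d L j x) (hWx : SmallField W x)
    (s : Site d) (Y : Site d → Fin d → Matrix n n ℂ) :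
    ∃ lam : Site d → Matrix n n ℂ,
      (∀ y, lam y ∈ skewAdjoint (Matrix n n ℂ)) ∧ (∀ (y : Site d) (i : Fin d), lam (y + ((N * L ^ (j + 1) : ℕ) : ℤ) • e i) = lam y) ∧
      (∀ nu : Site d → Matrix n n ℂ, (∀ y, nu y ∈ skewAdjoint (Matrix n n ℂ)) →
          (∀ (y : Site d) (i : Fin d), nu (y + ((N * L ^ (j + 1) : ℕ) : ℤ) • e i) = nu y) →
          (fun y => nu (y - s)) ∈ avgKernelGauges (d := d) (n := n) L N (j + 1) (fun y μ => W (y - s) μ) →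
        ∑ y ∈ periodBox (d := d) (N * L ^ (j + 1)), ∑ κ : Fin d, hsR (Y y κ + gaugeDir W lam y κ) (gaugeDir W (covLapSite W nu) y κ) = 0) := by
  have hP : 1 ≤ N * L ^ (j + 1) := Nat.mul_pos (by omega) (Nat.pow_pos (by omega))
  set P : ℕ := N * L ^ (j + 1) with hPdef
  set W' : Site d → Fin d → (Matrix n n ℂ)ˣ := fun y μ => W (y - s) μ with hW'
  have hW'u : IsUnitaryCfg W' := isUnitaryCfg_transl hWu s
  have hW'P : IsPeriodicCfg W' ((P : ℕ) : ℤ) := isPeriodicCfg_transl hWP s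
  have hW'x : SmallField W' x := smallField_transl hWx s
  -- periodise `Y` (the Landau sum only sees the period box), then translate
  set Yw : Site d → Fin d → Matrix n n ℂ := fun y κ => Y (fun ι => y ι % (P : ℤ)) κ with hYw
  have hYwP : IsPeriodicDir Yw (P : ℤ) := fun y i κ => by
    simp only [hYw]; rw [wrap_add_smul_e]
  obtain ⟨lam', hmem, hLan⟩ := exists_landauB8_correction hL hN j hW'u hW'P hx hs hW'x (fun y κ => Yw (y - s) κ)
  obtain ⟨hl's, hl'P, -⟩ := mem_avgKernelGauges_iff.mp hmem
  have hlamP0 : ∀ (y : Site d) (i : Fin d), lam' (y + ((P : ℕ) : ℤ) • e i + s) = lam' (y + s) :=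
    fun y i => by rw [add_right_comm, hl'P]
  have hlamP : ∀ (y : Site d) (i : Fin d), (fun y => lam' (y + s)) (y + ((P : ℕ) : ℤ) • e i) = (fun y => lam' (y + s)) y :=
    fun y i => hlamP0 y i
  refine ⟨fun y => lam' (y + s), fun y => hl's _, hlamP, fun nu hnus hnuP hnuT => ?_⟩
  have hlam_eq : (fun y => (fun y => lam' (y + s)) (y - s)) = lam' := by funext y; simp only [sub_add_cancel]
  -- the `W`-side summand (with `Yw`), its periodicity, and its relation to the `W′`-side summand
  set G : Site d → ℝ := fun y => ∑ κ : Fin d, hsR (Yw y κ + gaugeDir W (fun y => lam' (y + s)) y κ) (gaugeDir W (covLapSite W nu) y κ) with hG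
  have hGP : ∀ (y : Site d) (i : Fin d), G (y + ((P : ℕ) : ℤ) • e i) = G y := by
    intro y i
    simp only [hG]
    refine Finset.sum_congr rfl fun κ _ => ?_
    rw [hYwP y i κ, isPeriodicDir_gaugeDir hWP (lam := fun y => lam' (y + s)) hlamP y i κ,
      isPeriodicDir_gaugeDir hWP (covLapSite_add_period hWP hnuP) y i κ]
  have hGeq : ∀ y, (∑ κ : Fin d, hsR ((fun y κ => Yw (y - s) κ) y κ + gaugeDir W' lam' y κ) (gaugeDir W' (covLapSite W' (fun y => nu (y - s))) y κ))
      = G (y - s) := by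
    intro y
    simp only [hG]
    refine Finset.sum_congr rfl fun κ _ => ?_
    have e1 : gaugeDir W' lam' y κ = gaugeDir W (fun y => lam' (y + s)) (y - s) κ := by
      rw [← gaugeDir_transl W (fun y => lam' (y + s)) s y κ, hlam_eq]
    have e2 : gaugeDir W' (covLapSite W' (fun y => nu (y - s))) y κ = gaugeDir W (covLapSite W nu) (y - s) κ := by
      have hc : covLapSite W' (fun y => nu (y - s)) = fun y => covLapSite W nu (y - s) := by
        funext y'; exact covLapSite_transl W nu s y'
      rw [hc, gaugeDir_transl]
    rw [e1, e2]
  have hL0 := hLan (fun y => nu (y - s)) hnuT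
  simp_rw [hGeq] at hL0
  rw [sum_periodBox_sub hP hGP s] at hL0
  -- back to `Y` on the period box
  rw [← hL0]
  refine Finset.sum_congr rfl fun y hy => ?_
  simp only [hG, hYw, wrap_eq_self_of_mem hy]

/-- **GALERKIN PROJECTION OF THE TRANSLATED CLASS (`Δ` form, with E′'s two sup bounds)**: at a `W` of row NE3's class (with its radius lines), for every skew periodic
site field `F` there is a skew periodic `λ` with `F + Δ_Wλ` orthogonal to `Δ_Wν` for every periodic `ν` of the translated class, `‖Δ_Wλ‖ ≤ c_R^{E′}‖F‖`,
`‖λ‖ ≤ 36d(frameC+d)²M²·c_R^{E′}‖F‖` — F91 §1, `hRW_of_radii`, `supRegularity_uniform` at the translated background. [folklore] -/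
theorem galerkinR_transl [Nonempty n] (hd : 1 ≤ d) {L N : ℕ} [NeZero N] (hL : 2 ≤ L) (j : ℕ)
    {W : Site d → Fin d → (Matrix n n ℂ)ˣ} {x x₁ : ℝ} (hWu : IsUnitaryCfg W) (hWP : IsPeriodicCfg W ((N * L ^ (j + 1) : ℕ) : ℤ))
    (hx : 0 ≤ x) (hs : LevelSmall d L j x) (hWx : SmallField W x) (hx10 : 0 ≤ x₁)
    (hgrad : ∀ (p : Site d) (μ κ : Fin d), κ ≠ μ →
      ‖Ad (W p μ) ((hol W (p + e μ) (plaqWord κ μ) : (Matrix n n ℂ)ˣ) : Matrix n n ℂ) - ((hol W p (plaqWord κ μ) : (Matrix n n ℂ)ˣ) : Matrix n n ℂ)‖ ≤ x₁)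
    (hbx : 23040 * (d : ℝ) ^ 4 * (frameC d L + d) ^ 2 * ((L : ℝ) ^ (j + 1)) ^ 2 * x ≤ 1)
    (hcx : 11520 * (d : ℝ) ^ 4 * (frameC d L + d) ^ 3 * ((L : ℝ) ^ (j + 1)) ^ 3 * x₁ ≤ 1) (s : Site d) :
    ∀ F : Site d → Matrix n n ℂ, (∀ y, F y ∈ skewAdjoint (Matrix n n ℂ)) →
      (∀ (y : Site d) (i : Fin d), F (y + ((N * L ^ (j + 1) : ℕ) : ℤ) • e i) = F y) →
      ∃ lam₁ : Site d → Matrix n n ℂ,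
        (∀ y, lam₁ y ∈ skewAdjoint (Matrix n n ℂ)) ∧ (∀ (y : Site d) (i : Fin d), lam₁ (y + ((N * L ^ (j + 1) : ℕ) : ℤ) • e i) = lam₁ y) ∧
        (∀ nu : Site d → Matrix n n ℂ, (∀ y, nu y ∈ skewAdjoint (Matrix n n ℂ)) →
            (∀ (y : Site d) (i : Fin d), nu (y + ((N * L ^ (j + 1) : ℕ) : ℤ) • e i) = nu y) →
            (fun y => nu (y - s)) ∈ avgKernelGauges (d := d) (n := n) L N (j + 1) (fun y μ => W (y - s) μ) →
          ∑ y ∈ periodBox (d := d) (N * L ^ (j + 1)), hsR (F y + covLapSite W lam₁ y) (covLapSite W nu y) = 0) ∧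
        ∀ B : ℝ, (∀ y, ‖F y‖ ≤ B) →
          (∀ y, ‖covLapSite W lam₁ y‖ ≤ (1 + 2 * (Fintype.card n : ℝ) * (64 * (d : ℝ) ^ 2 * N) ^ d + 27 * (Fintype.card n : ℝ) ^ 3 * (512 : ℝ) ^ d * (N : ℝ) ^ d) * B) ∧
          (∀ y, ‖lam₁ y‖ ≤ (36 * d * (frameC d L + d) ^ 2) * ((L : ℝ) ^ (j + 1)) ^ 2
            * ((1 + 2 * (Fintype.card n : ℝ) * (64 * (d : ℝ) ^ 2 * N) ^ d + 27 * (Fintype.card n : ℝ) ^ 3 * (512 : ℝ) ^ d * (N : ℝ) ^ d) * B)) := by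
  intro F hFs hFP
  have hL1 : 1 ≤ L := by omega
  have hN : 1 ≤ N := Nat.one_le_iff_ne_zero.mpr (NeZero.ne N)
  have hP : 1 ≤ N * L ^ (j + 1) := Nat.mul_pos (by omega) (Nat.pow_pos (by omega))
  set W' : Site d → Fin d → (Matrix n n ℂ)ˣ := fun y μ => W (y - s) μ with hW'
  have hW'u : IsUnitaryCfg W' := isUnitaryCfg_transl hWu s
  have hW'P : IsPeriodicCfg W' ((N * L ^ (j + 1) : ℕ) : ℤ) := isPeriodicCfg_transl hWP s
  have hW'x : SmallField W' x := smallField_transl hWx s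
  have hgrad' := plaqGrad_transl hgrad s
  -- the translated datum
  set F' : Site d → Matrix n n ℂ := fun y => F (y - s) with hF'
  have hF's : ∀ y, F' y ∈ skewAdjoint (Matrix n n ℂ) := fun y => hFs _
  have hF'P : ∀ (y : Site d) (i : Fin d), F' (y + ((N * L ^ (j + 1) : ℕ) : ℤ) • e i) = F' y := sitePeriodic_transl hFP s
  obtain ⟨lam', hmem, horth'⟩ := exists_galerkinB8_site hL1 hN j hW'u hW'P hx hs hW'x F'
  obtain ⟨hl's, hl'P, -⟩ := mem_avgKernelGauges_iff.mp hmem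
  have hlamP : ∀ (y : Site d) (i : Fin d), lam' (y + ((N * L ^ (j + 1) : ℕ) : ℤ) • e i + s) = lam' (y + s) :=
    fun y i => by rw [add_right_comm, hl'P]
  have hlamP' : ∀ (y : Site d) (i : Fin d), (fun y => lam' (y + s)) (y + ((N * L ^ (j + 1) : ℕ) : ℤ) • e i) = (fun y => lam' (y + s)) y :=
    fun y i => hlamP y i
  have hlam_eq : (fun y => (fun y => lam' (y + s)) (y - s)) = lam' := by funext y; simp only [sub_add_cancel]
  have hΔeq : ∀ y, covLapSite W (fun y => lam' (y + s)) y = covLapSite W' lam' (y + s) := by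
    intro y
    have h := covLapSite_transl W (fun y => lam' (y + s)) s (y + s)
    rw [hlam_eq, add_sub_cancel_right] at h
    exact h.symm
  have hΔper : ∀ (y : Site d) (i : Fin d), covLapSite W (fun y => lam' (y + s)) (y + ((N * L ^ (j + 1) : ℕ) : ℤ) • e i)
      = covLapSite W (fun y => lam' (y + s)) y := covLapSite_add_period hWP (lam := fun y => lam' (y + s)) hlamP'
  refine ⟨fun y => lam' (y + s), fun y => hl's _, hlamP', fun nu hnus hnuP hnuT => ?_, fun B hFB => ?_⟩
  · -- orthogonality, translated back
    set H : Site d → ℝ := fun y => hsR (F y + covLapSite W (fun y => lam' (y + s)) y) (covLapSite W nu y) with hH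
    have hHP : ∀ (y : Site d) (i : Fin d), H (y + ((N * L ^ (j + 1) : ℕ) : ℤ) • e i) = H y := by
      intro y i
      simp only [hH, hFP y i, hΔper y i, covLapSite_add_period hWP hnuP y i]
    have hΔnu : ∀ y, covLapSite W' (fun y => nu (y - s)) y = covLapSite W nu (y - s) := fun y => by
      exact covLapSite_transl W nu s y
    have hΔlam : ∀ y, covLapSite W' lam' y = covLapSite W (fun y => lam' (y + s)) (y - s) := fun y => by
      rw [hΔeq, sub_add_cancel]
    have hHeq : ∀ y, hsR (F' y + covLapSite W' lam' y) (covLapSite W' (fun y => nu (y - s)) y) = H (y - s) := by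
      intro y
      simp only [hH, hF', hΔnu y, hΔlam y]
    have h0 := horth' (fun y => nu (y - s)) hnuT
    simp_rw [hHeq] at h0
    rwa [sum_periodBox_sub hP hHP s] at h0
  · have hF'B : ∀ y, ‖F' y‖ ≤ B := fun y => hFB _
    have hΔ' : ∀ y, ‖covLapSite W' lam' y‖
        ≤ (1 + 2 * (Fintype.card n : ℝ) * (64 * (d : ℝ) ^ 2 * N) ^ d + 27 * (Fintype.card n : ℝ) ^ 3 * (512 : ℝ) ^ d * (N : ℝ) ^ d) * B :=
      fun y => hRW_of_radii hd hL j hW'u hW'P hx hs hW'x hx10 hgrad' hbx hcx F' hF's hF'P lam' hmem horth' B hF'B y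
    refine ⟨fun y => ?_, fun y => ?_⟩
    · rw [hΔeq]; exact hΔ' _
    · exact (supRegularity_uniform hd hL j hW'u hW'P hx hs hW'x hx10 hgrad' hbx hcx hmem hΔ').2 (y + s)

/-! ## §3 THE PINNED REPRESENTATIVE, LANDAU AGAINST THE TRANSLATED CLASS, MODULO THE TRANSLATED LHCI -/

/-- **«REP WITH A FIXED TOP» FOR THE `s`-TRANSLATED TEST CLASS, MODULO ITS LHCI** (for `s = ⌊M∕2⌋·𝟙`: the DUAL, corner-centred class).  Data as in F91 §2; the LHCI of
`W` for the translated class by shape: `hI` (for every skew `N`-periodic corner datum `a` a skew periodic `η` with `η(M•w) = a(w)`, `gaugeDir_W η` Landau against the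
translated class, `‖Δ_Wη‖ ≤ (C_I∕M²)·sup‖a‖`) and `hIu` (uniqueness).  THEN: `u` unitary periodic with `u(M•z) = 1`, `Z` skew periodic Landau against the translated
class, `U^u = We^{Z}`, with E′'s radii at `c₁ = 36d²`, `c₀ = 36d³`, `c_R = c_R^{E′}(1 + C_I·36d(frameC+d)²)`. [folklore] -/
theorem exists_pinnedLandauRepTransl_of_lhci [Nonempty n] (hd : 1 ≤ d) {L N : ℕ} [NeZero N] (hL : 2 ≤ L) (j : ℕ) (s : Site d)
    {W : Site d → Fin d → (Matrix n n ℂ)ˣ} {x x₁ : ℝ} (hWu : IsUnitaryCfg W) (hWP : IsPeriodicCfg W ((N * L ^ (j + 1) : ℕ) : ℤ))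
    (hx : 0 ≤ x) (hs : LevelSmall d L j x) (hWx : SmallField W x) (hx10 : 0 ≤ x₁)
    (hgrad : ∀ (p : Site d) (μ κ : Fin d), κ ≠ μ →
      ‖Ad (W p μ) ((hol W (p + e μ) (plaqWord κ μ) : (Matrix n n ℂ)ˣ) : Matrix n n ℂ) - ((hol W p (plaqWord κ μ) : (Matrix n n ℂ)ˣ) : Matrix n n ℂ)‖ ≤ x₁)
    (hbx : 23040 * (d : ℝ) ^ 4 * (frameC d L + d) ^ 2 * ((L : ℝ) ^ (j + 1)) ^ 2 * x ≤ 1)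
    (hcx : 11520 * (d : ℝ) ^ 4 * (frameC d L + d) ^ 3 * ((L : ℝ) ^ (j + 1)) ^ 3 * x₁ ≤ 1)
    -- the LHCI of `W` for the translated class, by shape
    {CI : ℝ} (hCI : 0 ≤ CI)
    (hI : ∀ a : Site d → Matrix n n ℂ, (∀ w, a w ∈ skewAdjoint (Matrix n n ℂ)) → (∀ (w : Site d) (i : Fin d), a (w + (N : ℤ) • e i) = a w) →
      ∃ eta : Site d → Matrix n n ℂ,
        (∀ y, eta y ∈ skewAdjoint (Matrix n n ℂ)) ∧ (∀ (y : Site d) (i : Fin d), eta (y + ((N * L ^ (j + 1) : ℕ) : ℤ) • e i) = eta y) ∧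
        (∀ w : Site d, eta ((((L ^ (j + 1) : ℕ) : ℤ)) • w) = a w) ∧
        (∀ nu : Site d → Matrix n n ℂ, (∀ y, nu y ∈ skewAdjoint (Matrix n n ℂ)) →
            (∀ (y : Site d) (i : Fin d), nu (y + ((N * L ^ (j + 1) : ℕ) : ℤ) • e i) = nu y) →
            (fun y => nu (y - s)) ∈ avgKernelGauges (d := d) (n := n) L N (j + 1) (fun y μ => W (y - s) μ) →
          ∑ y ∈ periodBox (d := d) (N * L ^ (j + 1)), ∑ κ : Fin d, hsR (gaugeDir W eta y κ) (gaugeDir W (covLapSite W nu) y κ) = 0) ∧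
        ∀ A : ℝ, (∀ w, ‖a w‖ ≤ A) → ∀ y, ‖covLapSite W eta y‖ ≤ CI / ((L : ℝ) ^ (j + 1)) ^ 2 * A)
    (hIu : ∀ mu : Site d → Matrix n n ℂ, (∀ y, mu y ∈ skewAdjoint (Matrix n n ℂ)) →
      (∀ (y : Site d) (i : Fin d), mu (y + ((N * L ^ (j + 1) : ℕ) : ℤ) • e i) = mu y) → (∀ w : Site d, mu ((((L ^ (j + 1) : ℕ) : ℤ)) • w) = 0) →
      (∀ nu : Site d → Matrix n n ℂ, (∀ y, nu y ∈ skewAdjoint (Matrix n n ℂ)) →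
          (∀ (y : Site d) (i : Fin d), nu (y + ((N * L ^ (j + 1) : ℕ) : ℤ) • e i) = nu y) →
          (fun y => nu (y - s)) ∈ avgKernelGauges (d := d) (n := n) L N (j + 1) (fun y μ => W (y - s) μ) →
        ∑ y ∈ periodBox (d := d) (N * L ^ (j + 1)), hsR (covLapSite W mu y) (covLapSite W nu y) = 0) →
      ∀ y, covLapSite W mu y = 0)
    -- the constants, named; the field and its initial gauge; E′'s regime at these constants
    {c₀ c₁ cR cRE : ℝ} (hc₁ : c₁ = 36 * d * (d : ℝ)) (hc₀ : c₀ = 36 * d * (d : ℝ) ^ 2)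
    (hcRE : cRE = 1 + 2 * (Fintype.card n : ℝ) * (64 * (d : ℝ) ^ 2 * N) ^ d + 27 * (Fintype.card n : ℝ) ^ 3 * (512 : ℝ) ^ d * (N : ℝ) ^ d)
    (hcR : cR = cRE * (1 + CI * (36 * d * (frameC d L + d) ^ 2)))
    {U : Site d → Fin d → (Matrix n n ℂ)ˣ} (hUu : IsUnitaryCfg U) (hUP : IsPeriodicCfg U ((N * L ^ (j + 1) : ℕ) : ℤ))
    {r₀ b₀ : ℝ} (hr₀ : ∀ (y : Site d) (μ : Fin d), ‖(((W y μ)⁻¹ * U y μ : (Matrix n n ℂ)ˣ) : (Matrix n n ℂ)) - 1‖ ≤ r₀)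
    (hb₀ : ∀ x : Site d, ‖covDiv W (fun y μ => mlog (((W y μ)⁻¹ * U y μ : (Matrix n n ℂ)ˣ) : (Matrix n n ℂ))) x‖ ≤ b₀)
    (hreg₁ : c₀ * ((L : ℝ) ^ (j + 1)) ^ 2 * (cR * b₀) ≤ 1 / 10) (hreg₂ : c₁ * (L : ℝ) ^ (j + 1) * (cR * b₀) ≤ 1 / 25)
    (hreg₃ : r₀ + 5 / 2 * (c₁ * (L : ℝ) ^ (j + 1) * (cR * b₀)) ≤ 1 / 20)
    (hline : cR * (4 * (c₀ * ((L : ℝ) ^ (j + 1)) ^ 2) * (b₀ + 4 * (cR * b₀))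
        + 25 * d * (r₀ + 5 / 2 * (c₁ * (L : ℝ) ^ (j + 1) * (cR * b₀))) * (c₁ * (L : ℝ) ^ (j + 1))
        + 14 * d * (c₁ * (L : ℝ) ^ (j + 1)) ^ 2 * (cR * b₀)) ≤ 1 / 2) :
    ∃ (u : Site d → (Matrix n n ℂ)ˣ) (Z : Site d → Fin d → (Matrix n n ℂ)),
      IsUnitarySite u ∧ IsPeriodicSite u ((N * L ^ (j + 1) : ℕ) : ℤ) ∧ IsSkewDir Z ∧ IsPeriodicDir Z ((N * L ^ (j + 1) : ℕ) : ℤ) ∧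
      gaugeAct u U = vary W Z 1 ∧ (∀ w : Site d, u ((((L ^ (j + 1) : ℕ) : ℤ)) • w) = 1) ∧
      (∀ nu : Site d → Matrix n n ℂ, (∀ y, nu y ∈ skewAdjoint (Matrix n n ℂ)) →
          (∀ (y : Site d) (i : Fin d), nu (y + ((N * L ^ (j + 1) : ℕ) : ℤ) • e i) = nu y) →
          (fun y => nu (y - s)) ∈ avgKernelGauges (d := d) (n := n) L N (j + 1) (fun y μ => W (y - s) μ) →
        ∑ y ∈ periodBox (d := d) (N * L ^ (j + 1)), ∑ κ : Fin d, hsR (Z y κ) (gaugeDir W (covLapSite W nu) y κ) = 0) ∧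
      (∀ (y : Site d) (μ : Fin d), ‖(((W y μ)⁻¹ * gaugeAct u U y μ : (Matrix n n ℂ)ˣ) : (Matrix n n ℂ)) - 1‖ ≤ r₀ + 5 / 2 * (c₁ * (L : ℝ) ^ (j + 1) * (cR * b₀))) ∧
      (∀ (y : Site d) (μ : Fin d), ‖Z y μ‖ ≤ 2 * (r₀ + 5 / 2 * (c₁ * (L : ℝ) ^ (j + 1) * (cR * b₀)))) ∧
      (∀ y : Site d, ‖((u y : (Matrix n n ℂ)ˣ) : (Matrix n n ℂ)) - 1‖ ≤ 4 * (c₀ * ((L : ℝ) ^ (j + 1)) ^ 2 * (cR * b₀))) ∧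
      (∀ x : Site d, ‖covDiv W Z x‖ ≤ b₀ + 3 * (cR * b₀)) := by
  have hL1 : 1 ≤ L := by omega
  have hN : 1 ≤ N := Nat.one_le_iff_ne_zero.mpr (NeZero.ne N)
  have hP : 1 ≤ N * L ^ (j + 1) := Nat.mul_pos (by omega) (Nat.pow_pos (by omega))
  have hd1 : (1 : ℝ) ≤ d := by exact_mod_cast hd
  have hFC0 : 0 ≤ frameC d L := by unfold frameC; positivity
  have hc₀0 : 0 ≤ c₀ := by rw [hc₀]; positivity
  have hc₁0 : 0 ≤ c₁ := by rw [hc₁]; positivity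
  have hcRE1 : 1 ≤ cRE := by
    have h0 : 0 ≤ 2 * (Fintype.card n : ℝ) * (64 * (d : ℝ) ^ 2 * N) ^ d + 27 * (Fintype.card n : ℝ) ^ 3 * (512 : ℝ) ^ d * (N : ℝ) ^ d := by positivity
    rw [hcRE]; linarith
  have hcR1 : 1 ≤ cR := by
    rw [hcR]
    have h1 : (1 : ℝ) ≤ 1 + CI * (36 * d * (frameC d L + d) ^ 2) := by
      have : 0 ≤ CI * (36 * d * (frameC d L + d) ^ 2) := by positivity
      linarith
    nlinarith
  -- the test class
  set T : (Site d → Matrix n n ℂ) → Prop := fun nu => (fun y => nu (y - s)) ∈ avgKernelGauges (d := d) (n := n) L N (j + 1) (fun y μ => W (y - s) μ) with hT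
  -- F83's radius lines follow from E′'s (`d ≤ frameC + d`)
  have hdF : (d : ℝ) ≤ frameC d L + d := by linarith
  have hbx' : 23040 * (d : ℝ) ^ 4 * (d : ℝ) ^ 2 * ((L : ℝ) ^ (j + 1)) ^ 2 * x ≤ 1 := by
    have h1 : (d : ℝ) ^ 2 ≤ (frameC d L + d) ^ 2 := pow_le_pow_left₀ (by positivity) hdF 2
    have h2 : 23040 * (d : ℝ) ^ 4 * (d : ℝ) ^ 2 * ((L : ℝ) ^ (j + 1)) ^ 2 * x
        ≤ 23040 * (d : ℝ) ^ 4 * (frameC d L + d) ^ 2 * ((L : ℝ) ^ (j + 1)) ^ 2 * x := by gcongr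
    exact h2.trans hbx
  have hcx' : 11520 * (d : ℝ) ^ 4 * (d : ℝ) ^ 3 * ((L : ℝ) ^ (j + 1)) ^ 3 * x₁ ≤ 1 := by
    have h1 : (d : ℝ) ^ 3 ≤ (frameC d L + d) ^ 3 := pow_le_pow_left₀ (by positivity) hdF 3
    have h2 : 11520 * (d : ℝ) ^ 4 * (d : ℝ) ^ 3 * ((L : ℝ) ^ (j + 1)) ^ 3 * x₁
        ≤ 11520 * (d : ℝ) ^ 4 * (frameC d L + d) ^ 3 * ((L : ℝ) ^ (j + 1)) ^ 3 * x₁ := by gcongr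
    exact h2.trans hcx
  -- hG: (H0_W) on pointed generators, F83
  have hG : ∀ mu : Site d → Matrix n n ℂ, ((∀ y, mu y ∈ skewAdjoint (Matrix n n ℂ)) ∧
      (∀ (y : Site d) (i : Fin d), mu (y + ((N * L ^ (j + 1) : ℕ) : ℤ) • e i) = mu y) ∧ (∀ w : Site d, mu ((((L ^ (j + 1) : ℕ) : ℤ)) • w) = 0)) →
      ∀ B : ℝ, (∀ y : Site d, ‖covLapSite W mu y‖ ≤ B) →
        (∀ y : Site d, ‖mu y‖ ≤ c₀ * ((L : ℝ) ^ (j + 1)) ^ 2 * B) ∧ (∀ (y : Site d) (μ : Fin d), ‖gaugeDir W mu y μ‖ ≤ c₁ * (L : ℝ) ^ (j + 1) * B) := by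
    intro mu hmu B hB
    obtain ⟨hD, hS⟩ := supRegularity_pointed hd hL j hWu hWP hx hWx hx10 hgrad hbx' hcx' hmu.2.1 hmu.2.2 hB
    refine ⟨fun y => (hS y).trans (le_of_eq ?_), fun y μ => (hD y μ).trans (le_of_eq ?_)⟩
    · rw [hc₀]
    · rw [hc₁]
  -- hProj: F90 §2 from §2's projection and the LHCI existence
  have hGal := fun Y : Site d → Fin d → Matrix n n ℂ => galerkin_transl hL1 hN j hWu hWP hx hs hWx s Y
  have hIex : ∀ a : Site d → Matrix n n ℂ, (∀ w, a w ∈ skewAdjoint (Matrix n n ℂ)) → (∀ (w : Site d) (i : Fin d), a (w + (N : ℤ) • e i) = a w) →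
      ∃ eta : Site d → Matrix n n ℂ,
        (∀ y, eta y ∈ skewAdjoint (Matrix n n ℂ)) ∧ (∀ (y : Site d) (i : Fin d), eta (y + ((N * L ^ (j + 1) : ℕ) : ℤ) • e i) = eta y) ∧
        (∀ w : Site d, eta ((((L ^ (j + 1) : ℕ) : ℤ)) • w) = a w) ∧
        (∀ nu : Site d → Matrix n n ℂ, (∀ y, nu y ∈ skewAdjoint (Matrix n n ℂ)) →
            (∀ (y : Site d) (i : Fin d), nu (y + ((N * L ^ (j + 1) : ℕ) : ℤ) • e i) = nu y) → T nu →
          ∑ y ∈ periodBox (d := d) (N * L ^ (j + 1)), ∑ κ : Fin d, hsR (gaugeDir W eta y κ) (gaugeDir W (covLapSite W nu) y κ) = 0) := by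
    intro a has haP
    obtain ⟨eta, hes, heP, he0, heL, -⟩ := hI a has haP
    exact ⟨eta, hes, heP, he0, heL⟩
  have hProj := pinnedProj_of_galerkin_lhci (d := d) (n := n) j T hGal hIex
  -- hR: F90 §3 from §2's projection-with-bounds, the LHCI with its bound, and its uniqueness
  have hGalR := galerkinR_transl hd hL j hWu hWP hx hs hWx hx10 hgrad hbx hcx s
  have hR' := pinnedSupLetter_of_galerkin_lhci (d := d) (n := n) j hP T hWu hWP (c₀ := 36 * d * (frameC d L + d) ^ 2)
    (cR := 1 + 2 * (Fintype.card n : ℝ) * (64 * (d : ℝ) ^ 2 * N) ^ d + 27 * (Fintype.card n : ℝ) ^ 3 * (512 : ℝ) ^ d * (N : ℝ) ^ d) (CI := CI)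
    hGalR hI hIu
  have hR : ∀ (F : Site d → Matrix n n ℂ), (∀ y : Site d, F y ∈ skewAdjoint (Matrix n n ℂ)) →
      (∀ (y : Site d) (i : Fin d), F (y + ((N * L ^ (j + 1) : ℕ) : ℤ) • e i) = F y) →
      ∀ mu : Site d → Matrix n n ℂ, ((∀ y, mu y ∈ skewAdjoint (Matrix n n ℂ)) ∧ (∀ (y : Site d) (i : Fin d), mu (y + ((N * L ^ (j + 1) : ℕ) : ℤ) • e i) = mu y) ∧
        (∀ w : Site d, mu ((((L ^ (j + 1) : ℕ) : ℤ)) • w) = 0)) →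
        (∀ nu : Site d → Matrix n n ℂ, (∀ y, nu y ∈ skewAdjoint (Matrix n n ℂ)) →
          (∀ (y : Site d) (i : Fin d), nu (y + ((N * L ^ (j + 1) : ℕ) : ℤ) • e i) = nu y) → T nu →
          ∑ y ∈ periodBox (d := d) (N * L ^ (j + 1)), hsR (F y + covLapSite W mu y) (covLapSite W nu y) = 0) →
        ∀ B : ℝ, (∀ y : Site d, ‖F y‖ ≤ B) → ∀ y : Site d, ‖covLapSite W mu y‖ ≤ cR * B := by
    intro F hFs hFP mu hmu horth B hFB y
    have h := hR' F hFs hFP mu hmu horth B hFB y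
    rw [hcR, hcRE]
    linarith
  -- F89 with the translated class
  exact exists_pinnedLandauRep_W_T_of_supFacts hd hL hN j T hc₀0 hc₁0 hcR1 hWu hWP hG hR hProj hUu hUP hr₀ hb₀ hreg₁ hreg₂ hreg₃ hline

end

end Summit.QuantumFields.BalabanUV.T4Continuum.NE7PinnedLandauRepDual
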